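import Mathlib
import HarnessLib
import Summits.Langlands.Statement
import Summits.Langlands.Langlands.Theses.DepthPrimeSplit
import Summits.Langlands.Langlands.Theorems.TransientLevelSplitLevelFiniteness
import Summits.Langlands.Langlands.Theorems.WeakFernSplitFernSpread
import Summits.Langlands.Langlands.Theorems.FernRankSplitExchange
import Summits.Langlands.Langlands.Theorems.FernRankSplitFernSpread
import Literature.NumberTheory.Automorphic.GLnAdelicStructureProofs

/-!
# SolvableTransitSplit — lens-3 gen 31 node of the cell `decomp-langlands` (planner-decomp-langlands-lens-3-g31-0, 2026-08-31)

TYPED-NOT-FILED (freeze).  Target BY NAME: RANK = `Summit.Langlands.Langlands.Theorems.FernRank.FernRankBound` (the re-typed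
residual of FERN = `Summit.Langlands.Langlands.Theses.DepthPrimeSplit.FernSpread`, stmt-Langlands-25024; tree p833705), through which
FERN ⟺ HF ∧ RANK (`FernRank.fernSpread_iff_heckeFern_and_rankBound`).

## The move (lens 3: ONE certified translation + a split beneath)

Every earlier cut of the lineage (g24–g30) partitioned ρ-SPACE (level shapes, slope / regularity sectors) or re-typed the CONCLUSION
(C_pt, C_w, C_b, C_f).  g30 left inside RANK one sector tagged IDEA-NEEDED: INFINITE SLOPE (ρ not trianguline at some v ∣ ℓ: wild
p-adic Hodge type, invisible to every eigenvariety over K).  This node moves along the FIELD axis instead: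

* p-adic Hodge theory: a de Rham ρ_v is POTENTIALLY SEMISTABLE (Berger 2002, Thm. 0.7) — semistable over a finite Galois F'/K_v, and
  local Galois groups are SOLVABLE; a semistable ρ_v is trianguline after enlarging the coefficients (its (φ, N)-module has a full
  flag), i.e. FINITE SLOPE;
* class field theory: finitely many local solvable extensions are realised by ONE solvable Galois L/K, linearly disjoint from any given
  finite extension (CHT 2008 §4.1 / BLGGT 2014 §A.2 type lemma), so ρ|_L stays irreducible (Zariski-closure argument) and pinned-geometric.

Hence the infinite-slope sector is EMPTY modulo solvable layers, and RANK factors EXACTLY (trivial seam, like g29/g30):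

  RANK ⟺ SST ∧ TRANSIT                                   (`rankBound_iff_sst_and_transit`, modulo NOTHING)

  SST     = RANK with the extra hypothesis «ρ semistable at every v ∣ ℓ» (WD-reading through Fontaine's PINNED datum: de Rham and the
            attached Weil–Deligne representation is trivial on inertia) — the FINITE-SLOPE RANK over all number fields;
  TRANSIT = RANK assuming SST on every SOLVABLE SEMISTABLE LAYER L/K of ρ — «SOLVABLE TRANSIT OF APPROXIMATE AUTOMORPHY»: the residual is
            no longer a sector of representations but a functoriality statement for 𝒪/ℓ^m-valued points of bounded-level Hecke algebras
            along cyclic layers (tool class: Arthur–Clozel base change / descent for exact members; p-adic interpolation of cyclic base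
            change on eigenvarieties, Johansson–Newton 2019; Smith theory along ℤ/ℓ-layers, Treumann–Venkatesh 2016),

and beneath TRANSIT the anatomy (one-directional, `transit_of_pieces`):

  TRANSIT ⟸ COVER ∧ ASCENT ∧ DESCENT
  COVER   (support, Langlands-FREE, KNOWN in print: Berger + the solvable field-selection lemma + Clifford/Zariski) every irreducible
          pinned-geometric ρ has a solvable Galois layer L on which it is irreducible, pinned-geometric and semistable above ℓ;
  ASCENT  (Langlands-implied) residual automorphy H1 and weak pro-automorphy C_w ASCEND from K to every such layer;
  DESCENT (Langlands-implied, RANK-implied) bounded weak pro-automorphy C_b DESCENDS from one such layer to K.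

Every ledger-candidate piece is implied by the summit (`pieces_of_langlands` : Langlands → SST ∧ TRANSIT ∧ ASCENT ∧ DESCENT — no EXCESS);
COVER is not a consequence of reciprocity but a theorem of p-adic Hodge theory + CFT (typing debt: D2 `WD ∘ D_pst` and the restriction
functoriality of the pinned datum are not in the tree).  Frames: `closes_residual` (→ RANK), `closes_target` (→ FERN by name, with HF),
`closes_root` (→ `_root_.Langlands`, DepthPrimeSplit's eight binders with FERN replaced by HF, SST, TRANSIT).  0 sorry.

«semistable» HERE is the p-adic Hodge type of ρ AT v ∣ ℓ — not the Iwahori level shape of approximants at auxiliary places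
(gen 25–27 cuts, route BanalAuxiliarySplit's `SemistableShaping`), and the solvable layers serve a LOCAL purpose at ℓ — not the
base-field reach of route BaseFieldAscent / ResidualSolvabilitySplit (which transport EXACT reciprocity).
-/

namespace Summit.Langlands.Langlands.Theorems.FernTransit

open scoped NumberField
open Filter Field IsDedekindDomain
open Literature.NumberTheory.GaloisRepresentations Literature.NumberTheory.Automorphic Literature.NumberTheory.PAdicHodge
open Summit.Langlands.Langlands.Theorems.TransientLevel Summit.Langlands.Langlands.Theorems.WeakFern
open Summit.Langlands.Langlands.Theorems.FernRank
open Summit.Langlands.Langlands.Theses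

set_option linter.dupNamespace false
set_option linter.unusedVariables false

/-! ## 17. Vocabulary: semistability above ℓ (WD reading through the pinned datum) and solvable semistable layers -/

section Vocabulary

variable {K : Type} [Field K] [NumberField K] {n : ℕ} {ℓ : ℕ} [Fact ℓ.Prime]

/-- `ρ` is SEMISTABLE at the place `v ∣ ℓ` (Fontaine, read through the PINNED datum `fontainePstAdicCompletion v ℓ hv` exactly as the
accepted `PstWeilDeligneData.IsCrystallineFramed` reads «crystalline», minus `N = 0`): `ρ|Γ_{K_v}` is de Rham and its attached
Weil–Deligne representation is trivial on inertia (the inertia of `K_v` acts trivially on `D_pst`; `N` is free). -/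
def IsWdSemistableAt (v : HeightOneSpectrum (𝓞 K)) (hv : ((ℓ : ℕ) : 𝓞 K) ∈ v.asIdeal) (ρ : FramedGaloisRep K (PadicAlgCl ℓ) n) : Prop :=
  (fontainePstAdicCompletion v ℓ hv).IsDeRhamFramed (ρ.toLocal v) ∧
    ∃ r, (fontainePstAdicCompletion v ℓ hv).IsWeilDeligneOf (ρ.toLocal v) r ∧ WeilGroup.IsUnramifiedRep r.ρ

/-- `ρ` is semistable ABOVE ℓ: semistable at every `v ∣ ℓ` (the finite-slope world: semistable ⟹ trianguline after enlarging coefficients). -/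
def IsSemistableAbove (ρ : FramedGaloisRep K (PadicAlgCl ℓ) n) : Prop :=
  ∀ (v : HeightOneSpectrum (𝓞 K)) (hv : ((ℓ : ℕ) : 𝓞 K) ∈ v.asIdeal), IsWdSemistableAt v hv ρ

/-- `L/K` is a SOLVABLE SEMISTABLE LAYER of `ρ`: finite Galois with solvable group, on which `ρ` stays in the frame (irreducible,
pinned-geometric) and becomes semistable above ℓ. -/
def IsSemistableLayer (ρ : FramedGaloisRep K (PadicAlgCl ℓ) n) (L : Type) [Field L] [NumberField L] [Algebra K L] : Prop :=
  IsGalois K L ∧ IsSolvable (L ≃ₐ[K] L) ∧ (ρ.restrictField L).toGaloisRep.IsIrreducible ∧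
    IsPinnedGeometric (ρ.restrictField L) ∧ IsSemistableAbove (ρ.restrictField L)

/-- `ρ` HAS a solvable semistable layer. -/
def HasSemistableLayer (ρ : FramedGaloisRep K (PadicAlgCl ℓ) n) : Prop :=
  ∃ (L : Type) (_ : Field L) (_ : NumberField L) (_ : Algebra K L), IsSemistableLayer ρ L

/-- RANK holds on every solvable semistable layer of `ρ` (for the restriction `ρ|_L`, at every compact level datum of `L`): H1_L ⟹ C_w,L ⟹ C_b,L. -/
def SemistableLayerRank (ι : PadicAlgCl ℓ ≃+* ℂ) (ρ : FramedGaloisRep K (PadicAlgCl ℓ) n) : Prop :=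
  ∀ (L : Type) [Field L] [NumberField L] [Algebra K L], IsSemistableLayer ρ L →
    ∀ hcptL : isCompact_glFiniteIntegralLevel n L,
      IsResiduallyAutomorphic hcptL ι (ρ.restrictField L) → IsWeaklyProAutomorphic hcptL ι (ρ.restrictField L) →
        IsBoundedlyWeaklyProAutomorphic hcptL ι (ρ.restrictField L)

/-- H1 and C_w hold for `ρ|_L` on every solvable semistable layer (the conclusion of ASCENT). -/
def LayerAscends (ι : PadicAlgCl ℓ ≃+* ℂ) (ρ : FramedGaloisRep K (PadicAlgCl ℓ) n) : Prop :=
  ∀ (L : Type) [Field L] [NumberField L] [Algebra K L], IsSemistableLayer ρ L →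
    ∀ hcptL : isCompact_glFiniteIntegralLevel n L,
      IsResiduallyAutomorphic hcptL ι (ρ.restrictField L) ∧ IsWeaklyProAutomorphic hcptL ι (ρ.restrictField L)

/-- some solvable semistable layer carries BOUNDED weak pro-automorphy of `ρ|_L` (the hypothesis of DESCENT). -/
def HasBoundedLayer (ι : PadicAlgCl ℓ ≃+* ℂ) (ρ : FramedGaloisRep K (PadicAlgCl ℓ) n) : Prop :=
  ∃ (L : Type) (_ : Field L) (_ : NumberField L) (_ : Algebra K L), IsSemistableLayer ρ L ∧
    ∀ hcptL : isCompact_glFiniteIntegralLevel n L, IsBoundedlyWeaklyProAutomorphic hcptL ι (ρ.restrictField L)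

end Vocabulary

/-! ## 18. The items (structured over the landed vocabulary of the lineage; `Frame` = g29's common frame) -/

/-- SST · SEMISTABLE (FINITE-SLOPE) RANK · crux rank 2 of the split · WEAKER than RANK (`sst_of_rankBound`; probe SST ↛ RANK) · OPEN ·
ATTACKABLE-mod-PRINT at l₀ = 0 (semistable ⟹ trianguline; trianguline + promodular ⟹ overconvergent finite slope: Emerton 2011 Thm 1.2.4
for GL₂/ℚ, Breuil–Hellmann–Schraen 2017 for definite unitary groups; eigenvariety locally finite over weight space + small-slope
classicality ⟹ bounded-degree classical families of tame level S to every depth; then g30's EXCHANGE) · BARRIER l₀ > 0 (unchanged).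
RANK's binders and hypotheses VERBATIM plus «ρ semistable above ℓ»; conclusion C_b. -/
def SemistableRankBound : Prop :=
  Frame fun hcpt ι ρ => IsSemistableAbove ρ →
    IsResiduallyAutomorphic hcpt ι ρ → IsWeaklyProAutomorphic hcpt ι ρ → IsBoundedlyWeaklyProAutomorphic hcpt ι ρ

/-- TRANSIT · SOLVABLE TRANSIT OF APPROXIMATE AUTOMORPHY · crux rank 3 (the re-cut residual) · WEAKER than RANK (`transit_of_rankBound`;
probe TRANSIT ↛ RANK) · OPEN · IDEA-NEEDED (ascent / descent of 𝒪/ℓ^m-points of bounded-level Hecke algebras along cyclic layers; tool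
class Arthur–Clozel, Johansson–Newton eigenvariety functoriality, Treumann–Venkatesh Smith theory) · UNDECIDED whether two-valued.
RANK's binders and hypotheses VERBATIM plus «RANK holds for ρ|_L on every solvable semistable layer L»; conclusion C_b. -/
def SolvableTransit : Prop :=
  Frame fun hcpt ι ρ => IsResiduallyAutomorphic hcpt ι ρ → IsWeaklyProAutomorphic hcpt ι ρ →
    SemistableLayerRank ι ρ → IsBoundedlyWeaklyProAutomorphic hcpt ι ρ

/-- COVER · SOLVABLE SEMISTABLE COVER · support (rank 9) · Langlands-FREE · KNOWN in print (Berger 2002 Thm 0.7 de Rham ⟹ potentially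
semistable; solvable field-selection with prescribed local behaviour and linear disjointness, CHT 2008 §4.1 / BLGGT 2014 §A.2; ρ|_L
irreducible for L linearly disjoint from the finite extension cut out by π₀ of the Zariski closure) · typing debt (D2 `WD ∘ D_pst`,
restriction functoriality of the pinned datum). -/
def SemistableSolvableCover : Prop :=
  ∀ (K : Type) [Field K] [NumberField K] (n : ℕ), 0 < n → ∀ (ℓ : ℕ) [Fact ℓ.Prime] (ρ : FramedGaloisRep K (PadicAlgCl ℓ) n),
    ρ.toGaloisRep.IsIrreducible → IsPinnedGeometric ρ → HasSemistableLayer ρ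

/-- ASCENT · SOLVABLE ASCENT OF RESIDUAL AND WEAK PRO-AUTOMORPHY · crux rank 4 · Langlands-implied (`ascent_of_langlands`), NOT
RANK-implied · ATTACKABLE-mod-PRINT for exact members (Arthur–Clozel III.4.2/III.5.1 solvable base change, cuspidal iff π ≇ π ⊗ η) ·
IDEA-NEEDED-light for the Hecke-algebra point (base change of a weak eigen-system = pull-back of 𝒪-relations along the power maps on
Satake parameters; members with Eisenstein base change must be replaced). -/
def SolvableWeakAscent : Prop :=
  Frame fun hcpt ι ρ => IsResiduallyAutomorphic hcpt ι ρ → IsWeaklyProAutomorphic hcpt ι ρ → LayerAscends ι ρ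

/-- DESCENT · SOLVABLE DESCENT OF BOUNDED WEAK PRO-AUTOMORPHY · crux rank 5 · WEAKER than RANK (`descent_of_rankBound`) · OPEN ·
IDEA-NEEDED (cyclic descent of approximate eigen-systems: ρ|_L is a Gal(L/K)-fixed point of the layer's fern; exact σ-fixed cuspidal
members descend by Arthur–Clozel, approximate ones need interpolation — Johansson–Newton / Smith theory). -/
def SolvableProDescent : Prop :=
  Frame fun hcpt ι ρ => IsResiduallyAutomorphic hcpt ι ρ → IsWeaklyProAutomorphic hcpt ι ρ →
    HasBoundedLayer ι ρ → IsBoundedlyWeaklyProAutomorphic hcpt ι ρ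

/-! ## 19. Kernel: non-vacuity of the semistable world, and the summit on layers -/

section Kernel

variable {K : Type} [Field K] [NumberField K] {n : ℕ} {ℓ : ℕ} [Fact ℓ.Prime]

/-- Representations unramified at `v ∣ ℓ` are semistable there (datum axioms: unramified ⟹ de Rham, `WD` unramified) — the hypothesis of
SST is satisfiable (vacuity defence). -/
theorem isWdSemistableAt_of_isLocallyUnramified {v : HeightOneSpectrum (𝓞 K)} {hv : ((ℓ : ℕ) : 𝓞 K) ∈ v.asIdeal}
    {ρ : FramedGaloisRep K (PadicAlgCl ℓ) n} (h : (ρ.toLocal v).IsLocallyUnramified) : IsWdSemistableAt v hv ρ := by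
  have hdR := (fontainePstAdicCompletion v ℓ hv).isDeRhamFramed_of_isLocallyUnramified h
  obtain ⟨r, hr⟩ := hdR.exists_isWeilDeligneOf
  exact ⟨hdR, r, hr, ((fontainePstAdicCompletion v ℓ hv).wd_of_isLocallyUnramified _ r h hr).2⟩

/-- … hence a `ρ` unramified at every `v ∣ ℓ` is semistable above ℓ. -/
theorem isSemistableAbove_of_isLocallyUnramified {ρ : FramedGaloisRep K (PadicAlgCl ℓ) n}
    (h : ∀ (v : HeightOneSpectrum (𝓞 K)), ((ℓ : ℕ) : 𝓞 K) ∈ v.asIdeal → (ρ.toLocal v).IsLocallyUnramified) : IsSemistableAbove ρ :=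
  fun v hv => isWdSemistableAt_of_isLocallyUnramified (h v hv)

omit [NumberField K] in
/-- a bounded layer is in particular a semistable layer. -/
theorem hasSemistableLayer_of_hasBoundedLayer {ι : PadicAlgCl ℓ ≃+* ℂ} {ρ : FramedGaloisRep K (PadicAlgCl ℓ) n}
    (h : HasBoundedLayer ι ρ) : HasSemistableLayer ρ := by
  obtain ⟨L, _, _, _, hLay, _⟩ := h
  exact ⟨L, ‹Field L›, ‹NumberField L›, ‹Algebra K L›, hLay⟩

/-- the summit gives C (pro-automorphy of bounded level) for every irreducible pinned-geometric ρ over every number field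
(`Rec.pst` is Fontaine's pinned datum by `rfl`; g24's proof shape). -/
theorem pro_of_langlands (hL : _root_.Langlands) (hcpt : isCompact_glFiniteIntegralLevel n K) (hn : 0 < n) (ι : PadicAlgCl ℓ ≃+* ℂ)
    (ρ : FramedGaloisRep K (PadicAlgCl ℓ) n) (hirr : ρ.toGaloisRep.IsIrreducible) (hgeo : IsPinnedGeometric ρ) :
    IsProAutomorphic hcpt ι ρ := by
  obtain ⟨⟨Rec⟩, h⟩ := hL K
  obtain ⟨π, hπ, hcorr⟩ := (h Rec n hn hcpt).2 ℓ ι ρ hirr ⟨hgeo.1, fun v hv => hgeo.2 v hv⟩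
  exact pro_of_weakly ⟨π, hπ, hcorr.1⟩

/-- every number field carries the compact integral level datum (accepted `isCompact_glFiniteIntegralLevel_holds`): the `∀ hcptL`
binders of the layer predicates are never vacuous. -/
theorem layerLevel_nonempty (L : Type) [Field L] [NumberField L] : Nonempty (isCompact_glFiniteIntegralLevel n L) :=
  ⟨isCompact_glFiniteIntegralLevel_holds n L⟩

end Kernel

/-! ## 20. The EQUIV: RANK ⟺ SST ∧ TRANSIT (modulo NOTHING) -/

/-- RANK ⟹ SST (drop the semistability hypothesis). -/
theorem sst_of_rankBound (h : FernRankBound) : SemistableRankBound :=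
  fun K _ _ n hcpt hn ℓ _ ι ρ hirr hgeo _hss h1 hw => h K n hcpt hn ℓ ι ρ hirr hgeo h1 hw

/-- RANK ⟹ TRANSIT (ignore the layers). -/
theorem transit_of_rankBound (h : FernRankBound) : SolvableTransit :=
  fun K _ _ n hcpt hn ℓ _ ι ρ hirr hgeo h1 hw _hB => h K n hcpt hn ℓ ι ρ hirr hgeo h1 hw

/-- SST ∧ TRANSIT ⟹ RANK: SST instantiated OVER THE LAYER discharges TRANSIT's bracket (both binders used). -/
theorem rankBound_of_sst_of_transit (h₁ : SemistableRankBound) (h₂ : SolvableTransit) : FernRankBound :=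
  fun K _ _ n hcpt hn ℓ _ ι ρ hirr hgeo h1 hw =>
    h₂ K n hcpt hn ℓ ι ρ hirr hgeo h1 hw fun L _ _ _ hLay hcptL h1L hwL =>
      h₁ L n hcptL hn ℓ ι (ρ.restrictField L) hLay.2.2.1 hLay.2.2.2.1 hLay.2.2.2.2 h1L hwL

/-- ONE EQUIV of the node: RANK ⟺ SST ∧ TRANSIT. -/
theorem rankBound_iff_sst_and_transit : FernRankBound ↔ SemistableRankBound ∧ SolvableTransit :=
  ⟨fun h => ⟨sst_of_rankBound h, transit_of_rankBound h⟩, fun h => rankBound_of_sst_of_transit h.1 h.2⟩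

/-- the same at FERN (by name): FERN ⟺ HF ∧ SST ∧ TRANSIT. -/
theorem fernSpread_iff_three : DepthPrimeSplit.FernSpread ↔ HeckeFern ∧ SemistableRankBound ∧ SolvableTransit := by
  rw [fernSpread_iff_heckeFern_and_rankBound, rankBound_iff_sst_and_transit]

/-- and at W2S (g29's residual, by name): W2S ⟺ SST ∧ TRANSIT. -/
theorem weakToStrong_iff_sst_and_transit : WeakToStrongFern ↔ SemistableRankBound ∧ SolvableTransit := by
  rw [← rankBound_iff_weakToStrong, rankBound_iff_sst_and_transit]

/-! ## 21. The split beneath the EQUIV: TRANSIT ⟸ COVER ∧ ASCENT ∧ DESCENT -/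

/-- the anatomy of the transit: COVER supplies the layer, ASCENT carries H1 and C_w up, the bracket (SST on the layer) bounds the rank
upstairs, DESCENT brings C_b down (all three binders and the bracket used). -/
theorem transit_of_pieces (hC : SemistableSolvableCover) (hA : SolvableWeakAscent) (hD : SolvableProDescent) : SolvableTransit := by
  intro K _ _ n hcpt hn ℓ _ ι ρ hirr hgeo h1 hw hB
  obtain ⟨L, _, _, _, hLay⟩ := hC K n hn ℓ ρ hirr hgeo
  refine hD K n hcpt hn ℓ ι ρ hirr hgeo h1 hw ⟨L, ‹Field L›, ‹NumberField L›, ‹Algebra K L›, hLay, fun hcptL => ?_⟩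
  have hA' := hA K n hcpt hn ℓ ι ρ hirr hgeo h1 hw L hLay hcptL
  exact hB L hLay hcptL hA'.1 hA'.2

/-- RANK ⟹ DESCENT (the conclusion from RANK's own hypotheses). -/
theorem descent_of_rankBound (h : FernRankBound) : SolvableProDescent :=
  fun K _ _ n hcpt hn ℓ _ ι ρ hirr hgeo h1 hw _ => h K n hcpt hn ℓ ι ρ hirr hgeo h1 hw

/-- RANK ∧ COVER ∧ ASCENT ⟹ the bracket is dischargeable: with COVER and ASCENT, SST ⟹ every ρ has a BOUNDED layer. -/
theorem hasBoundedLayer_of_pieces (h₁ : SemistableRankBound) (hC : SemistableSolvableCover) (hA : SolvableWeakAscent)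
    {K : Type} [Field K] [NumberField K] {n : ℕ} (hcpt : isCompact_glFiniteIntegralLevel n K) (hn : 0 < n) {ℓ : ℕ} [Fact ℓ.Prime]
    (ι : PadicAlgCl ℓ ≃+* ℂ) (ρ : FramedGaloisRep K (PadicAlgCl ℓ) n) (hirr : ρ.toGaloisRep.IsIrreducible) (hgeo : IsPinnedGeometric ρ)
    (h1 : IsResiduallyAutomorphic hcpt ι ρ) (hw : IsWeaklyProAutomorphic hcpt ι ρ) : HasBoundedLayer ι ρ := by
  obtain ⟨L, _, _, _, hLay⟩ := hC K n hn ℓ ρ hirr hgeo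
  refine ⟨L, ‹Field L›, ‹NumberField L›, ‹Algebra K L›, hLay, fun hcptL => ?_⟩
  have hA' := hA K n hcpt hn ℓ ι ρ hirr hgeo h1 hw L hLay hcptL
  exact h₁ L n hcptL hn ℓ ι (ρ.restrictField L) hLay.2.2.1 hLay.2.2.2.1 hLay.2.2.2.2 hA'.1 hA'.2

/-! ## 22. No EXCESS: every ledger-candidate piece is implied by the summit (COVER is Langlands-free print knowledge) -/

/-- Langlands ⟹ ASCENT: the summit OVER THE LAYER applied to ρ|_L (irreducible and pinned-geometric there by the layer predicate). -/
theorem ascent_of_langlands (hL : _root_.Langlands) : SolvableWeakAscent :=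
  fun K _ _ n hcpt hn ℓ _ ι ρ hirr hgeo _ _ L _ _ _ hLay hcptL =>
    have hp := pro_of_langlands hL hcptL hn ι (ρ.restrictField L) hLay.2.2.1 hLay.2.2.2.1
    ⟨residual_of_pro hp, weakly_of_pro hp⟩

/-- Langlands ⟹ SST. -/ theorem sst_of_langlands (hL : _root_.Langlands) : SemistableRankBound := sst_of_rankBound (rankBound_of_langlands hL)
/-- Langlands ⟹ TRANSIT. -/ theorem transit_of_langlands (hL : _root_.Langlands) : SolvableTransit := transit_of_rankBound (rankBound_of_langlands hL)
/-- Langlands ⟹ DESCENT. -/ theorem descent_of_langlands (hL : _root_.Langlands) : SolvableProDescent := descent_of_rankBound (rankBound_of_langlands hL)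

/-- ROOT-IMPLIED certificate: the summit implies SST, TRANSIT, ASCENT, DESCENT. -/
theorem pieces_of_langlands (hL : _root_.Langlands) : SemistableRankBound ∧ SolvableTransit ∧ SolvableWeakAscent ∧ SolvableProDescent :=
  ⟨sst_of_langlands hL, transit_of_langlands hL, ascent_of_langlands hL, descent_of_langlands hL⟩

/-- necessity from FERN: FERN ⟹ SST ∧ TRANSIT ∧ DESCENT. -/
theorem pieces_of_fernSpread (hF : DepthPrimeSplit.FernSpread) : SemistableRankBound ∧ SolvableTransit ∧ SolvableProDescent :=
  have h := rankBound_of_fernSpread hF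
  ⟨sst_of_rankBound h, transit_of_rankBound h, descent_of_rankBound h⟩

/-! ## 23. Frames: residual, target (FERN by name), root (`_root_.Langlands`) -/

/-- residual frame: SST → TRANSIT → RANK. -/
theorem closes_residual (h₁ : SemistableRankBound) (h₂ : SolvableTransit) : FernRankBound :=
  rankBound_of_sst_of_transit h₁ h₂

/-- residual frame through the anatomy: SST → COVER → ASCENT → DESCENT → RANK. -/
theorem closes_residual_pieces (h₁ : SemistableRankBound) (hC : SemistableSolvableCover) (hA : SolvableWeakAscent)
    (hD : SolvableProDescent) : FernRankBound :=
  closes_residual h₁ (transit_of_pieces hC hA hD)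

/-- target frame (the child route's `closes` shape): HF → SST → TRANSIT → FERN, by name through `FernRank.closes_target`. -/
theorem closes_target (hH : HeckeFern) (h₁ : SemistableRankBound) (h₂ : SolvableTransit) : DepthPrimeSplit.FernSpread :=
  FernRank.closes_target hH (closes_residual h₁ h₂)

/-- target frame through the anatomy: HF → SST → COVER → ASCENT → DESCENT → FERN. -/
theorem closes_target_pieces (hH : HeckeFern) (h₁ : SemistableRankBound) (hC : SemistableSolvableCover) (hA : SolvableWeakAscent)
    (hD : SolvableProDescent) : DepthPrimeSplit.FernSpread :=
  closes_target hH h₁ (transit_of_pieces hC hA hD)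

/-- root frame: `DepthPrimeSplit.closes` with FERN replaced by HF, SST, TRANSIT (ten binders → the summit; CLASS etc. by name). -/
theorem closes_root (hD : DepthPrimeSplit.DyadicSeed) (hO : DepthPrimeSplit.OddPrimeSeed) (hH : HeckeFern) (h₁ : SemistableRankBound)
    (h₂ : SolvableTransit) (hC : DepthPrimeSplit.Classicality) (hW : DepthPrimeSplit.SatakeAvatarExistence)
    (hP : DepthPrimeSplit.PadicMemberCompatibility) (hA : DepthPrimeSplit.CompatibilityAwayFromLR)
    (hR : DepthPrimeSplit.CanonicalReciprocityData) : _root_.Langlands :=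
  FernRank.closes_root hD hO hH (closes_residual h₁ h₂) hC hW hP hA hR

/-- root frame through the anatomy (twelve binders). -/
theorem closes_root_pieces (hD : DepthPrimeSplit.DyadicSeed) (hO : DepthPrimeSplit.OddPrimeSeed) (hH : HeckeFern)
    (h₁ : SemistableRankBound) (hCo : SemistableSolvableCover) (hAs : SolvableWeakAscent) (hDe : SolvableProDescent)
    (hC : DepthPrimeSplit.Classicality) (hW : DepthPrimeSplit.SatakeAvatarExistence) (hP : DepthPrimeSplit.PadicMemberCompatibility)
    (hA : DepthPrimeSplit.CompatibilityAwayFromLR) (hR : DepthPrimeSplit.CanonicalReciprocityData) : _root_.Langlands :=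
  closes_root hD hO hH h₁ (transit_of_pieces hCo hAs hDe) hC hW hP hA hR

end Summit.Langlands.Langlands.Theorems.FernTransit
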